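import Literature.Barriers.PneNP.ApproximationMethodLimit
import HarnessLib

/-!
# Barrier `ApproximationMethodLimit`: the probabilistic limit `ρ(f, 𝓜, x) ≤ 12(n₀+1)`, proved

Companion proof file (D-0014) of `Literature/Barriers/PneNP/ApproximationMethodLimit.lean`. It
DISCHARGES the named fact `Literature.Barriers.PneNP.ApproximationMethodLimitProb` — the
"moreover" part of Razborov's theorem on the limits of the method of approximations in the
presentation of J. Pich, *Localizability of the approximation method*, comput. complex. 33 (2024)
= arXiv:2212.09285 [Pich2024], §3.1 Thm. 2 (arXiv p. 9; primary source [Razborov1989]):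
for every legitimate model `𝓜` of order `n` over `{¬, ∨₂, ∧₂}` with `¬̄ = ¬`, every `f ∈ F_n`
with `n₀` essential inputs, every probability vector `μ` on `{0,1}ⁿ` and every `d > 0` bounding
the `μ`-probability of all error sets over `𝓜`, some `g ∈ 𝓜` has `Pr_μ[f ≠ g] ≤ 12(n₀+1)·d`.

**The printed proof (Pich 2024, §3.1, pp. 9–10).** "The existence of such `g` follows from the
following inequality, `Pr[𝐡(𝐱) ≠ f(𝐱)] ≤ 12(n₀+1) Pr[𝐱 ∈ 𝛅] ≤ 12(n₀+1)d`", a direct corollary of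
**Lemma 1**: there are a random error set `𝛅 ∈ Δ` and a random `𝐡 ∈ 𝓜` with
`Pr[𝐡(x) ≠ f(x)] ≤ 12(n₀+1)·Pr[x ∈ 𝛅]` for every `x`. Here `𝐡 := D̄_𝐠` is the approximator
(Def. 2) of the circuit `D_g := (C_{f⊕g} ∧ C_{¬g}) ∨ (C_{¬(f⊕g)} ∧ C_g)` — which computes `f` — for
the trivial exponential-size circuits `C_h := (C_{h¹} ∧ x_m) ∨ (C_{h⁰} ∧ ¬x_m)` and a uniformly
random `𝐠`; **Claim 3.1**: if `D̄_g(x) ≠ f(x)` then `x` lies in the error set of one of `3 + 12n`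
gate positions of `D_g` on the path of `x` (the `3` top gates, and in each of the `4` subcircuits,
per level, the `∨` gate and the two `∧` gates); the positions have `3(n+1)` types `⟨m, t⟩`, at
most `4` positions per type, and "since all functions `f ⊕ 𝐠, ¬𝐠, ¬(f ⊕ 𝐠), 𝐠` are uniformly
random", the probability that `x` lies in the error set at a position of type `k` is the
probability that `x` lies in the random error set `𝛅` conditioned on type `k` (a uniformly random
sub-table `g_m ∈ F_m`), whence the factor `4 · 3(n+1) = 12(n+1)`; with only the `n₀` essential
variables expanded, `12(n₀+1)`.

**Formalisation.** Everything is built over the essential inputs of `f` only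
(`apply_eq_of_agree_essential`: `f` is determined by them; `v : Fin n₀ → Fin n` enumerates
`essentialInputs f`). Boolean functions of the `k` remaining essential variables are TRUTH TABLES
`TruthTable k` (`TruthTable (k+1) = TruthTable k × TruthTable k`, split on the first variable —
Pich splits on the last, which is immaterial), so that the uniform distribution (`TruthTable.avg`)
restricts to the uniform distribution on each half (`TruthTable.avg_half`) and `g ↦ f ⊕ g`,
`g ↦ ¬g`, … are involutions (`TruthTable.mix_involutive`, `TruthTable.avg_comp_involutive`) —
this is the "uniformly random" step. The approximator `C̄_h` is `trivApprox` (in `𝓜`,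
`trivApprox_mem`, sub-namespace `ApproximationMethod`), its three error sets per level
are `errAt`, and Claim 3.1 is proved one level at a time (`trivApprox_succ_ne`: an error at `x`
is in one of the three error sets of the top level or persists in the half selected by `x`),
giving by induction `Pr_h[C̄_h(x) ≠ h(x)] ≤ lvlBound` (`avg_trivApprox_ne_le`), where `lvlBound`
is the sum over the `3k` level types of `Pr_{h}[x ∈ δ_type(h)]`; the top gates of `D_g` are
handled likewise (`topApprox`, `topErr`, `topApprox_ne`, `avg_topApprox_ne_le`, factor `4` from
the four sub-tables `child`). Averaging over `x ∼ μ` and using that every error set involved is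
an error set over `𝓜` (probability `≤ d`: `pr_errAt_le`, `pr_topErr_le`,
`sum_mul_lvlBound_le`) gives `E_g Pr_μ[D̄_g ≠ f] ≤ (3 + 12n₀)·d ≤ 12(n₀+1)·d`
(`avg_pr_topApprox_ne_le`), and some `g` does at least as well as the average
(`TruthTable.exists_le_of_avg_le`). The random error set `𝛅` of the source is never materialised
as a single random variable: only the per-type averages that constitute `Pr[x ∈ 𝛅]` appear. No
Chernoff bound is needed for this part of Thm. 2 (that is Case I of the `O(n n₀)` bound, whose
proof is not vendored here). The constant obtained is in fact `3 + 12n₀ ≤ 12(n₀+1)`.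

## Sources

* [Pich2024] §2.1 Def. 1–4 and the probabilistic approach (arXiv pp. 7–8); §3.1 Thm. 2
  ("Moreover …"), Lemma 1, Claim 3.1 with proofs (pp. 9–10) — held (`lit read arxiv:2212.09285`).
* [Razborov1989] A. A. Razborov, *On the method of approximations*, STOC 1989 — primary source,
  through [Pich2024].
-/

noncomputable section

namespace Literature.Barriers.PneNP

open Finset Function

variable {n : ℕ}

/-! ### Essential inputs determine `f` -/

/-- Membership in `essentialInputs`. [folklore] -/
theorem mem_essentialInputs (f : (Fin n → Bool) → Bool) (i : Fin n) :
    i ∈ essentialInputs f ↔ IsEssentialVar f i := by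
  simp [essentialInputs]

/-- **`f` is determined by its essential inputs**: inputs agreeing on every essential variable
give the same value (flip the other coordinates one at a time). [folklore] -/
theorem apply_eq_of_agree_essential (f : (Fin n → Bool) → Bool) (x x' : Fin n → Bool)
    (h : ∀ i, IsEssentialVar f i → x i = x' i) : f x' = f x := by
  classical
  have key : ∀ S : Finset (Fin n), f (fun i => if i ∈ S then x' i else x i) = f x := by
    intro S
    induction S using Finset.induction_on with
    | empty => simp
    | insert j S hj ih =>
      have hupd : (fun i => if i ∈ insert j S then x' i else x i) =
          Function.update (fun i => if i ∈ S then x' i else x i) j (x' j) := by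
        funext i
        by_cases hij : i = j
        · subst hij; simp
        · rw [Function.update_of_ne hij]; simp [hij]
      rw [hupd]
      by_cases hess : IsEssentialVar f j
      · have hxj : x' j = (fun i => if i ∈ S then x' i else x i) j := by
          simp [hj, h j hess]
        rw [hxj, Function.update_eq_self, ih]
      · have hall : ∀ z : Fin n → Bool,
            f (Function.update z j true) = f (Function.update z j false) := by
          intro z
          by_contra hz
          exact hess ⟨z, hz⟩
        set z := (fun i => if i ∈ S then x' i else x i) with hz
        have h1 : f (Function.update z j (x' j)) = f (Function.update z j (z j)) := by
          cases x' j <;> cases z j <;> simp [hall z]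
        rw [h1, Function.update_eq_self, ih]
  simpa using key univ

/-- `Pr_μ[S] = Σ_x μ(x)·𝟙[x ∈ S]`. [folklore] -/
theorem ProbVector.pr_eq_sum_ite (μ : ProbVector n) (S : Finset (Fin n → Bool)) :
    μ.pr S = ∑ x, μ.w x * (if x ∈ S then 1 else 0) := by
  unfold ProbVector.pr
  simp only [mul_ite, mul_one, mul_zero]
  rw [sum_ite_mem, univ_inter]

/-! ## The proof of Lemma 1 and of the "moreover" part of Thm. 2

The constructions of the printed proof live in the sub-namespace `ApproximationMethod` (proof
infrastructure, not catalogue entries). -/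

namespace ApproximationMethod

/-! ### Truth tables of the remaining essential variables -/

/-- **Truth tables** of Boolean functions of `k` variables, split on the first variable:
`TruthTable 0 = Bool`, `TruthTable (k+1) = TruthTable k × TruthTable k` (the pair `(h¹, h⁰)` of
Pich's `hᵃ := h(…, a)`, here with the first instead of the last variable fixed).
[cite: Pich2024, §3.1, proof of Lemma 1 (p. 9: "Given h ∈ F_m, let hᵃ := h(x₁,…,x_{m−1},a) ∈ F_{m−1}")] -/
def TruthTable : ℕ → Type
  | 0 => Bool
  | k + 1 => TruthTable k × TruthTable k

namespace TruthTable

/-- Truth tables form a finite type (`2^(2^k)` of them). [folklore] -/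
instance instFintype : ∀ k, Fintype (TruthTable k)
  | 0 => show Fintype Bool from inferInstance
  | k + 1 =>
    haveI := instFintype k
    show Fintype (TruthTable k × TruthTable k) from inferInstance

/-- Truth tables are inhabited. [folklore] -/
instance instInhabited : ∀ k, Inhabited (TruthTable k)
  | 0 => show Inhabited Bool from inferInstance
  | k + 1 =>
    haveI := instInhabited k
    show Inhabited (TruthTable k × TruthTable k) from inferInstance

/-- The half `hᵇ` of a table (first variable set to `b`).
[cite: Pich2024, §3.1, proof of Lemma 1 (p. 9: hᵃ)] -/
def half {k : ℕ} (h : TruthTable (k + 1)) (b : Bool) : TruthTable k :=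
  cond b (show TruthTable k × TruthTable k from h).1 (show TruthTable k × TruthTable k from h).2

/-- The table with halves `p` (first variable true) and `q` (false). [folklore] -/
def node {k : ℕ} (p q : TruthTable k) : TruthTable (k + 1) :=
  show TruthTable k × TruthTable k from (p, q)

/-- The leaf table of a constant. [folklore] -/
def leaf (b : Bool) : TruthTable 0 := show Bool from b

/-- `(node p q)¹ = p`. [folklore] -/
@[simp] theorem half_node_true {k : ℕ} (p q : TruthTable k) : (node p q).half true = p := rfl

/-- `(node p q)⁰ = q`. [folklore] -/
@[simp] theorem half_node_false {k : ℕ} (p q : TruthTable k) : (node p q).half false = q := rfl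

/-- A table is the node of its halves. [folklore] -/
theorem node_half {k : ℕ} (h : TruthTable (k + 1)) : node (h.half true) (h.half false) = h := rfl

/-- **Evaluation** of a table at an assignment of its `k` variables (the function `[[C_h]] = h`
computed by the trivial circuit). [cite: Pich2024, §3.1, proof of Lemma 1 (p. 9: C_h computes h)] -/
def eval : (k : ℕ) → TruthTable k → (Fin k → Bool) → Bool
  | 0, b, _ => show Bool from b
  | k + 1, h, y => eval k (h.half (y 0)) (Fin.tail y)

/-- Evaluation of a leaf. [folklore] -/
@[simp] theorem eval_leaf (b : Bool) (y : Fin 0 → Bool) : eval 0 (leaf b) y = b := rfl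

/-- Evaluation descends into the half selected by the first variable. [folklore] -/
theorem eval_succ {k : ℕ} (h : TruthTable (k + 1)) (y : Fin (k + 1) → Bool) :
    eval (k + 1) h y = eval k (h.half (y 0)) (Fin.tail y) := rfl

/-- The truth table of a Boolean function. [folklore] -/
def ofFun : (k : ℕ) → ((Fin k → Bool) → Bool) → TruthTable k
  | 0, g => leaf (g Fin.elim0)
  | k + 1, g =>
    node (ofFun k fun y => g (Fin.cons true y)) (ofFun k fun y => g (Fin.cons false y))

/-- The truth table of `g` evaluates to `g`. [folklore] -/
theorem eval_ofFun : ∀ (k : ℕ) (g : (Fin k → Bool) → Bool) (y : Fin k → Bool),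
    eval k (ofFun k g) y = g y
  | 0, g, y => by
    simp only [ofFun, eval_leaf]
    congr 1; funext i; exact i.elim0
  | k + 1, g, y => by
    rw [eval_succ, ofFun]
    cases hy : y 0
    · rw [half_node_false, eval_ofFun k]
      conv_rhs => rw [← Fin.cons_self_tail y, hy]
    · rw [half_node_true, eval_ofFun k]
      conv_rhs => rw [← Fin.cons_self_tail y, hy]

/-- The pointwise operation `g ↦ (τ ⊕ g) ⊕ b` on tables (`f ⊕ g`, `¬g`, `¬(f ⊕ g)`, `g` are its
four instances). [cite: Pich2024, §3.1, proof of Lemma 1 (p. 9: D_g)] -/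
def mix : (k : ℕ) → TruthTable k → Bool → TruthTable k → TruthTable k
  | 0, τ, b, g => leaf ((eval 0 τ Fin.elim0 ^^ eval 0 g Fin.elim0) ^^ b)
  | k + 1, τ, b, g =>
    node (mix k (τ.half true) b (g.half true)) (mix k (τ.half false) b (g.half false))

/-- `mix` is pointwise `(τ ⊕ g) ⊕ b`. [folklore] -/
theorem eval_mix : ∀ (k : ℕ) (τ : TruthTable k) (b : Bool) (g : TruthTable k) (y : Fin k → Bool),
    eval k (mix k τ b g) y = ((eval k τ y ^^ eval k g y) ^^ b)
  | 0, τ, b, g, y => by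
    have hy : y = Fin.elim0 := funext fun i => i.elim0
    subst hy
    simp [mix]
  | k + 1, τ, b, g, y => by
    rw [eval_succ, eval_succ, eval_succ, mix]
    cases y 0
    · rw [half_node_false, eval_mix k]
    · rw [half_node_true, eval_mix k]

/-- `mix τ b` is an involution ("all functions `f ⊕ 𝐠, ¬𝐠, ¬(f ⊕ 𝐠), 𝐠` are uniformly random").
[cite: Pich2024, §3.1, proof of Lemma 1 (p. 10)] -/
theorem mix_mix : ∀ (k : ℕ) (τ : TruthTable k) (b : Bool) (g : TruthTable k),
    mix k τ b (mix k τ b g) = g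
  | 0, τ, b, g => by
    revert τ b g
    show ∀ (τ : Bool) (b : Bool) (g : Bool), _
    intro τ b g
    cases τ <;> cases b <;> cases g <;> rfl
  | k + 1, τ, b, g => by
    rw [mix, mix, half_node_true, half_node_false, mix_mix k, mix_mix k, node_half]

/-- `mix τ b` is an involution. [cite: Pich2024, §3.1, proof of Lemma 1 (p. 10)] -/
theorem mix_involutive (k : ℕ) (τ : TruthTable k) (b : Bool) : Function.Involutive (mix k τ b) :=
  mix_mix k τ b

/-- `|TruthTable (k+1)| = |TruthTable k|²`. [folklore] -/
theorem card_succ (k : ℕ) : Fintype.card (TruthTable (k + 1)) =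
    Fintype.card (TruthTable k) * Fintype.card (TruthTable k) := by
  show Fintype.card (TruthTable k × TruthTable k) = _
  exact Fintype.card_prod _ _

/-- Summing over `TruthTable (k+1)` is summing over both halves. [folklore] -/
theorem sum_succ (k : ℕ) (φ : TruthTable (k + 1) → ℝ) :
    ∑ h, φ h = ∑ p : TruthTable k, ∑ q : TruthTable k, φ (node p q) := by
  show (∑ h : TruthTable k × TruthTable k, φ h) = _
  rw [Fintype.sum_prod_type]
  rfl

/-! ### Uniform averages over truth tables -/

/-- **Expectation under a uniformly random table** `𝐠 ∈ TruthTable k`.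
[cite: Pich2024, §3.1, proof of Lemma 1 (p. 9: "for uniformly random 𝐠 on F_n")] -/
def avg (k : ℕ) (φ : TruthTable k → ℝ) : ℝ := (∑ h, φ h) / Fintype.card (TruthTable k)

/-- There is at least one table. [folklore] -/
theorem card_pos (k : ℕ) : (0 : ℝ) < Fintype.card (TruthTable k) := by
  exact_mod_cast Fintype.card_pos

/-- Averages are monotone. [folklore] -/
theorem avg_mono {k : ℕ} {φ ψ : TruthTable k → ℝ} (h : ∀ t, φ t ≤ ψ t) : avg k φ ≤ avg k ψ :=
  div_le_div_of_nonneg_right (sum_le_sum fun t _ => h t) (card_pos k).le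

/-- Averages are additive. [folklore] -/
theorem avg_add {k : ℕ} (φ ψ : TruthTable k → ℝ) :
    avg k (fun t => φ t + ψ t) = avg k φ + avg k ψ := by
  rw [avg, sum_add_distrib, add_div]; rfl

/-- Averages commute with finite sums. [folklore] -/
theorem avg_sum {k : ℕ} {ι : Type*} (s : Finset ι) (φ : ι → TruthTable k → ℝ) :
    avg k (fun t => ∑ i ∈ s, φ i t) = ∑ i ∈ s, avg k (φ i) := by
  simp only [avg]
  rw [sum_comm, sum_div]

/-- The average of a constant. [folklore] -/
theorem avg_const {k : ℕ} (c : ℝ) : avg k (fun _ => c) = c := by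
  rw [avg, sum_const, card_univ, nsmul_eq_mul, mul_div_cancel_left₀ _ (card_pos k).ne']

/-- An average of quantities `≤ c` is `≤ c`. [folklore] -/
theorem avg_le_of_le {k : ℕ} {φ : TruthTable k → ℝ} {c : ℝ} (h : ∀ t, φ t ≤ c) : avg k φ ≤ c := by
  rw [avg, div_le_iff₀ (card_pos k)]
  calc ∑ t, φ t ≤ ∑ _t : TruthTable k, c := sum_le_sum fun t _ => h t
    _ = c * Fintype.card (TruthTable k) := by rw [sum_const, card_univ, nsmul_eq_mul, mul_comm]

/-- Some table does at least as well as the average ("we can fix `g`"). [folklore] -/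
theorem exists_le_of_avg_le {k : ℕ} {φ : TruthTable k → ℝ} {c : ℝ} (h : avg k φ ≤ c) :
    ∃ t, φ t ≤ c := by
  by_contra hne
  push Not at hne
  have : c < avg k φ := by
    rw [avg, lt_div_iff₀ (card_pos k)]
    calc c * Fintype.card (TruthTable k) = ∑ _t : TruthTable k, c := by
          rw [sum_const, card_univ, nsmul_eq_mul, mul_comm]
      _ < ∑ t, φ t := sum_lt_sum_of_nonempty univ_nonempty fun t _ => hne t
  exact absurd h (not_le.2 this)

/-- A uniformly random table stays uniformly random under an involution of the tables.
[cite: Pich2024, §3.1, proof of Lemma 1 (p. 10: "all functions f ⊕ 𝐠, ¬𝐠, ¬(f ⊕ 𝐠), 𝐠 are uniformly random")] -/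
theorem avg_comp_involutive {k : ℕ} (φ : TruthTable k → ℝ) {σ : TruthTable k → TruthTable k}
    (hσ : Function.Involutive σ) : avg k (fun t => φ (σ t)) = avg k φ := by
  simp only [avg]
  rw [hσ.bijective.sum_comp φ]

/-- **Each half of a uniformly random table is uniformly random** (the restriction `g_m ∈ F_m` of
a uniform `g_n ∈ F_n` is uniform).
[cite: Pich2024, §3.1, proof of Lemma 1 (p. 10: Pr[x ∈ 𝛅 ∣ T(𝛅) = k] = Pr_{g_m ∈ F_m}[x ∈ δ¹])] -/
theorem avg_half {k : ℕ} (b : Bool) (φ : TruthTable k → ℝ) :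
    avg (k + 1) (fun h => φ (h.half b)) = avg k φ := by
  simp only [avg]
  rw [sum_succ, card_succ, Nat.cast_mul]
  cases b
  · simp only [half_node_false]
    rw [sum_const, card_univ, nsmul_eq_mul, mul_div_mul_left _ _ (card_pos k).ne']
  · simp only [half_node_true]
    simp only [sum_const, card_univ, nsmul_eq_mul]
    rw [← mul_sum, mul_div_mul_left _ _ (card_pos k).ne']

end TruthTable

/-! ### Indicators and weighted sums -/

/-- The indicator of a proposition, as a real number. [folklore] -/
def ind (p : Prop) [Decidable p] : ℝ := if p then 1 else 0

/-- Indicators are monotone under implication. [folklore] -/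
theorem ind_imp_le {p q : Prop} [Decidable p] [Decidable q] (h : p → q) : ind p ≤ ind q := by
  unfold ind
  by_cases hp : p
  · rw [if_pos hp, if_pos (h hp)]
  · rw [if_neg hp]; split_ifs <;> norm_num

/-- Union bound for two events. [folklore] -/
theorem ind_or_le (p q : Prop) [Decidable p] [Decidable q] [Decidable (p ∨ q)] :
    ind (p ∨ q) ≤ ind p + ind q := by
  unfold ind
  by_cases hp : p <;> by_cases hq : q <;> norm_num [hp, hq]

/-- Union bound for finitely many events. [folklore] -/
theorem ind_exists_le {ι : Type*} [Fintype ι] (P : ι → Prop) [DecidablePred P]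
    [Decidable (∃ i, P i)] : ind (∃ i, P i) ≤ ∑ i, ind (P i) := by
  unfold ind
  split_ifs with h
  · obtain ⟨i, hi⟩ := h
    calc (1 : ℝ) = if P i then 1 else 0 := by rw [if_pos hi]
      _ ≤ ∑ j, if P j then (1 : ℝ) else 0 :=
        single_le_sum (f := fun j => if P j then (1 : ℝ) else 0)
          (fun j _ => by split_ifs <;> norm_num) (mem_univ i)
  · exact sum_nonneg fun j _ => by split_ifs <;> norm_num

/-- `Pr_μ[S] = Σ_x μ(x)·ind[x ∈ S]`. [folklore] -/
theorem pr_eq_sum_ind (μ : ProbVector n) (S : Finset (Fin n → Bool)) :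
    μ.pr S = ∑ x, μ.w x * ind (x ∈ S) :=
  μ.pr_eq_sum_ite S

/-- Fubini: `Σ_x μ(x)·E_g[ψ(g, x)] = E_g[Σ_x μ(x)·ψ(g, x)]`. [folklore] -/
theorem sum_mul_avg {k : ℕ} (μ : ProbVector n) (ψ : TruthTable k → (Fin n → Bool) → ℝ) :
    ∑ x, μ.w x * TruthTable.avg k (fun h => ψ h x) =
      TruthTable.avg k (fun h => ∑ x, μ.w x * ψ h x) := by
  simp only [TruthTable.avg, ← mul_div_assoc]
  rw [← sum_div]
  congr 1
  simp only [mul_sum]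
  exact sum_comm

/-! ### The approximators `C̄_h` of the trivial circuits and their error sets -/

variable (M : LegitimateModel n)

/-- The literals `x_i` (`true`) and `¬x_i` (`false`).
[cite: Pich2024, §3.1, proof of Lemma 1 (p. 9: C_h := (C_{h¹} ∧ x_m) ∨ (C_{h⁰} ∧ ¬x_m))] -/
def lit : Bool → Fin n → (Fin n → Bool) → Bool
  | true, i => fun x => x i
  | false, i => fun x => !x i

/-- Literals lie in every legitimate model (`x_i ∈ 𝓜`, and `¬̄ = ¬` maps `𝓜` to `𝓜`).
[cite: Pich2024, §2.1 Def. 1 (p. 7) and §3.1 Thm. 2 (p. 9)] -/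
theorem lit_mem (b : Bool) (i : Fin n) : lit b i ∈ M.carrier := by
  cases b
  · exact M.compl_mem _ (M.proj_mem i)
  · exact M.proj_mem i

/-- `lit true i = x_i`. [folklore] -/
@[simp] theorem lit_true_apply (i : Fin n) (x : Fin n → Bool) : lit true i x = x i := rfl

/-- `lit false i = ¬x_i`. [folklore] -/
@[simp] theorem lit_false_apply (i : Fin n) (x : Fin n → Bool) : lit false i x = !x i := rfl

/-- **The approximator `C̄_h`** (Def. 2 applied to the trivial circuit `C_h`) of a table `h` of the
`k` variables `w 0, …, w (k-1)`: `∨̄ (∧̄ (C̄_{h¹}, x_{w 0}), ∧̄ (C̄_{h⁰}, ¬x_{w 0}))`, constants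
at the leaves. [cite: Pich2024, §2.1 Def. 2 (p. 7) and §3.1, proof of Lemma 1 (p. 9: C_h)] -/
def trivApprox : (k : ℕ) → (Fin k → Fin n) → TruthTable k → (Fin n → Bool) → Bool
  | 0, _, b => fun _ => TruthTable.eval 0 b Fin.elim0
  | k + 1, w, h => M.approx .or
      (M.approx .and (trivApprox k (w ∘ Fin.succ) (h.half true)) (lit true (w 0)))
      (M.approx .and (trivApprox k (w ∘ Fin.succ) (h.half false)) (lit false (w 0)))

/-- `C̄_h ∈ 𝓜`. [cite: Pich2024, §2.1 Def. 1–2 (p. 7)] -/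
theorem trivApprox_mem :
    ∀ (k : ℕ) (w : Fin k → Fin n) (h : TruthTable k), trivApprox M k w h ∈ M.carrier
  | 0, _, _ => M.const_mem _
  | k + 1, _, _ => M.approx_mem _ _ _
      (M.approx_mem _ _ _ (trivApprox_mem k _ _) (lit_mem M _ _))
      (M.approx_mem _ _ _ (trivApprox_mem k _ _) (lit_mem M _ _))

/-- The approximator `∧̄ (C̄_{hᵇ}, lit b)` of a top `∧` gate of `C_h`.
[cite: Pich2024, §3.1, proof of Lemma 1 (p. 9)] -/
def andApx (k : ℕ) (w : Fin (k + 1) → Fin n) (h : TruthTable (k + 1)) (b : Bool) :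
    (Fin n → Bool) → Bool :=
  M.approx .and (trivApprox M k (w ∘ Fin.succ) (h.half b)) (lit b (w 0))

/-- Unfolding `C̄_h` at the top `∨` gate. [folklore] -/
theorem trivApprox_succ (k : ℕ) (w : Fin (k + 1) → Fin n) (h : TruthTable (k + 1)) :
    trivApprox M (k + 1) w h = M.approx .or (andApx M k w h true) (andApx M k w h false) := rfl

/-- **The three error sets at the top level of `C_h`** (the types `t ∈ {∨, 0, 1}` of the random
error set `𝛅` for a level `m`): `none` = `δ_∨` of the `∨` gate, `some b` = `δ_∧` of the `∧` gate
with the literal `b`.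
[cite: Pich2024, §3.1, proof of Lemma 1 (pp. 9–10: definition of 𝛅, cases m ∈ [n])] -/
def errAt (k : ℕ) (w : Fin (k + 1) → Fin n) (h : TruthTable (k + 1)) :
    Option Bool → Finset (Fin n → Bool)
  | none => M.errSet .or (andApx M k w h true) (andApx M k w h false)
  | some b => M.errSet .and (trivApprox M k (w ∘ Fin.succ) (h.half b)) (lit b (w 0))

/-- The level error sets are error sets over `𝓜`, hence of probability `≤ d`
("the second inequality holds by the definition of `d`").
[cite: Pich2024, §3.1, proof of Thm. 2 (p. 9)] -/
theorem pr_errAt_le (μ : ProbVector n) {d : ℝ}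
    (hd : ∀ (c : Conn) (f₁ f₂ : (Fin n → Bool) → Bool), f₁ ∈ M.carrier → f₂ ∈ M.carrier →
      μ.pr (M.errSet c f₁ f₂) ≤ d)
    (k : ℕ) (w : Fin (k + 1) → Fin n) (h : TruthTable (k + 1)) (t : Option Bool) :
    μ.pr (errAt M k w h t) ≤ d := by
  rcases t with _ | b
  · exact hd _ _ _ (M.approx_mem _ _ _ (trivApprox_mem M _ _ _) (lit_mem M _ _))
      (M.approx_mem _ _ _ (trivApprox_mem M _ _ _) (lit_mem M _ _))
  · exact hd _ _ _ (trivApprox_mem M _ _ _) (lit_mem M _ _)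

/-- Membership in a (symmetric) error set. [cite: Pich2024, §2.1 Def. 3 (p. 7)] -/
theorem mem_errSet_iff (c : Conn) (f g : (Fin n → Bool) → Bool) (x : Fin n → Bool) :
    x ∈ M.errSet c f g ↔ c.apply (f x) (g x) ≠ M.approx c f g x := by
  simp [LegitimateModel.errSet]

/-- **Claim 3.1, one level**: if `C̄_h` errs at `x`, then `x` lies in one of the three error sets of
the top level, or `C̄_{hᵃ}` errs at `x` for the half `a = x_{w 0}` consistent with `x`.
[cite: Pich2024, §3.1 Claim 3.1 with proof (pp. 9–10)] -/
theorem trivApprox_succ_ne {k : ℕ} (w : Fin (k + 1) → Fin n) (h : TruthTable (k + 1))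
    (x : Fin n → Bool) (hne : trivApprox M (k + 1) w h x ≠ TruthTable.eval (k + 1) h (x ∘ w)) :
    (∃ t, x ∈ errAt M k w h t) ∨
      trivApprox M k (w ∘ Fin.succ) (h.half (x (w 0))) x ≠
        TruthTable.eval k (h.half (x (w 0))) (x ∘ w ∘ Fin.succ) := by
  by_contra hcon
  push Not at hcon
  obtain ⟨herr, hchild⟩ := hcon
  apply hne
  have h0 := herr none
  have h1 := herr (some true)
  have h2 := herr (some false)
  simp only [errAt, mem_errSet_iff, not_not, Conn.apply, andApx] at h0 h1 h2
  rw [trivApprox_succ, andApx, andApx, ← h0, ← h1, ← h2, TruthTable.eval_succ]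
  change _ = TruthTable.eval k (h.half (x (w 0))) (x ∘ w ∘ Fin.succ)
  rw [← hchild]
  simp only [lit_true_apply, lit_false_apply]
  cases x (w 0) <;> simp

/-- **The level part of `Pr[x ∈ 𝛅]`**: the sum over the `3k` types `⟨level, t⟩` of the probability,
over a uniformly random table of that level, that `x` lies in the error set of type `t`.
[cite: Pich2024, §3.1, proof of Lemma 1 (p. 10: Σ_k Pr[x ∈ 𝛅 ∣ T(𝛅) = k])] -/
def lvlBound : (k : ℕ) → (Fin k → Fin n) → (Fin n → Bool) → ℝ
  | 0, _, _ => 0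
  | k + 1, w, x =>
    (∑ t : Option Bool, TruthTable.avg (k + 1) fun h => if x ∈ errAt M k w h t then 1 else 0) +
      lvlBound k (w ∘ Fin.succ) x

/-- **Lemma 1 inside `C_h`**: for every `x`, the probability over a uniformly random table `h`
that `C̄_h(x) ≠ h(x)` is at most the level part of `Pr[x ∈ 𝛅]` (union bound over the positions
on the path of `x`, Claim 3.1, and uniformity of the halves).
[cite: Pich2024, §3.1 Lemma 1 with proof (pp. 9–10)] -/
theorem avg_trivApprox_ne_le : ∀ (k : ℕ) (w : Fin k → Fin n) (x : Fin n → Bool),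
    TruthTable.avg k (fun h => ind (trivApprox M k w h x ≠ TruthTable.eval k h (x ∘ w))) ≤
      lvlBound M k w x
  | 0, w, x => by
    have : ∀ h : TruthTable 0, ind (trivApprox M 0 w h x ≠ TruthTable.eval 0 h (x ∘ w)) = 0 := by
      intro h
      unfold ind
      rw [if_neg]
      simp only [trivApprox, ne_eq, not_not]
      congr 1
      funext i; exact i.elim0
    simp only [this, TruthTable.avg_const, lvlBound, le_refl]
  | k + 1, w, x => by
    classical
    have hpt : ∀ h : TruthTable (k + 1),
        ind (trivApprox M (k + 1) w h x ≠ TruthTable.eval (k + 1) h (x ∘ w)) ≤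
        (∑ t : Option Bool, ind (x ∈ errAt M k w h t)) +
          ind (trivApprox M k (w ∘ Fin.succ) (h.half (x (w 0))) x ≠
            TruthTable.eval k (h.half (x (w 0))) (x ∘ w ∘ Fin.succ)) := by
      intro h
      refine (ind_imp_le (trivApprox_succ_ne M w h x)).trans ((ind_or_le _ _).trans ?_)
      gcongr
      exact ind_exists_le _
    refine (TruthTable.avg_mono hpt).trans ?_
    rw [TruthTable.avg_add, TruthTable.avg_sum, lvlBound]
    refine add_le_add le_rfl ?_
    rw [TruthTable.avg_half (x (w 0)) (fun h' =>
      ind (trivApprox M k (w ∘ Fin.succ) h' x ≠ TruthTable.eval k h' (x ∘ w ∘ Fin.succ)))]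
    exact avg_trivApprox_ne_le k (w ∘ Fin.succ) x

/-- **Averaging the level part over `x ∼ μ`**: `Σ_x μ(x)·lvlBound(x) ≤ 3k·d`, since each of the
`3k` types contributes the `μ`-probability of an error set over `𝓜`.
[cite: Pich2024, §3.1, proof of Thm. 2 (p. 9: "≤ 12(n₀+1) Pr[𝐱 ∈ 𝛅] ≤ 12(n₀+1)d")] -/
theorem sum_mul_lvlBound_le (μ : ProbVector n) {d : ℝ}
    (hd : ∀ (c : Conn) (f₁ f₂ : (Fin n → Bool) → Bool), f₁ ∈ M.carrier → f₂ ∈ M.carrier →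
      μ.pr (M.errSet c f₁ f₂) ≤ d) :
    ∀ (k : ℕ) (w : Fin k → Fin n), ∑ x, μ.w x * lvlBound M k w x ≤ 3 * k * d
  | 0, w => by simp [lvlBound]
  | k + 1, w => by
    simp only [lvlBound, mul_add, sum_add_distrib, mul_sum]
    rw [sum_comm]
    have h1 : ∀ t : Option Bool,
        ∑ x, μ.w x * TruthTable.avg (k + 1) (fun h => if x ∈ errAt M k w h t then 1 else 0) ≤
          d := by
      intro t
      rw [sum_mul_avg]
      refine TruthTable.avg_le_of_le fun h => ?_
      rw [← show μ.pr (errAt M k w h t) = ∑ x, μ.w x * (if x ∈ errAt M k w h t then 1 else 0) from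
        pr_eq_sum_ind μ _]
      exact pr_errAt_le M μ hd k w h t
    have h3 : ∑ t : Option Bool,
        ∑ x, μ.w x * TruthTable.avg (k + 1) (fun h => if x ∈ errAt M k w h t then 1 else 0) ≤
          3 * d := by
      calc _ ≤ ∑ _t : Option Bool, d := sum_le_sum fun t _ => h1 t
        _ = 3 * d := by
          simp only [sum_const, card_univ, Fintype.card_option, Fintype.card_bool, nsmul_eq_mul]
          norm_num
    have ih := sum_mul_lvlBound_le μ hd k (w ∘ Fin.succ)
    push_cast
    linarith

/-! ### The random approximator `𝐡 = D̄_𝐠` (Lemma 1) -/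

section Top

variable {n₀ : ℕ} (v : Fin n₀ → Fin n) (τ z : TruthTable n₀)

/-- The four sub-tables of `D_g` as images of `g` under involutions: with `τ` the table of `f` and
`z` the zero table, `child a b g = ((a ? τ : z) ⊕ g) ⊕ b`, i.e. `(true,false) ↦ f ⊕ g`,
`(false,true) ↦ ¬g`, `(true,true) ↦ ¬(f ⊕ g)`, `(false,false) ↦ g`.
[cite: Pich2024, §3.1, proof of Lemma 1 (p. 9: D_g := (C_{f⊕g} ∧ C_{¬g}) ∨ (C_{¬(f⊕g)} ∧ C_g))] -/
def child (a b : Bool) (g : TruthTable n₀) : TruthTable n₀ :=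
  TruthTable.mix n₀ (cond a τ z) b g

/-- Each `child a b` is an involution of the tables.
[cite: Pich2024, §3.1, proof of Lemma 1 (p. 10: "uniformly random")] -/
theorem child_involutive (a b : Bool) : Function.Involutive (child τ z a b) :=
  TruthTable.mix_involutive n₀ _ _

/-- **The approximator `𝐡 = D̄_g`**: `∨̄ (∧̄ (C̄_{f⊕g}, C̄_{¬g}), ∧̄ (C̄_{¬(f⊕g)}, C̄_g))`.
[cite: Pich2024, §3.1, proof of Lemma 1 (p. 9: "Define the random variable 𝐡 := D̄_𝐠")] -/
def topApprox (g : TruthTable n₀) : (Fin n → Bool) → Bool :=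
  M.approx .or
    (M.approx .and (trivApprox M n₀ v (child τ z true false g))
      (trivApprox M n₀ v (child τ z false true g)))
    (M.approx .and (trivApprox M n₀ v (child τ z true true g))
      (trivApprox M n₀ v (child τ z false false g)))

/-- `D̄_g ∈ 𝓜` ("a random variable `𝐡` on `𝓜`"). [cite: Pich2024, §3.1 Lemma 1 (p. 9)] -/
theorem topApprox_mem (g : TruthTable n₀) : topApprox M v τ z g ∈ M.carrier :=
  M.approx_mem _ _ _ (M.approx_mem _ _ _ (trivApprox_mem M _ _ _) (trivApprox_mem M _ _ _))
    (M.approx_mem _ _ _ (trivApprox_mem M _ _ _) (trivApprox_mem M _ _ _))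

/-- **The error sets of the three top gates of `D_g`** (the types `⟨⊕, t⟩`, `t ∈ {∨, 0, 1}`):
`none` = `δ_∨` of the output gate, `some true` = `δ_∧(C̄_{f⊕g}, C̄_{¬g})`,
`some false` = `δ_∧(C̄_{¬(f⊕g)}, C̄_g)`.
[cite: Pich2024, §3.1, proof of Lemma 1 (pp. 9–10: definition of 𝛅, cases m = ⊕)] -/
def topErr (g : TruthTable n₀) : Option Bool → Finset (Fin n → Bool)
  | none => M.errSet .or
      (M.approx .and (trivApprox M n₀ v (child τ z true false g))
        (trivApprox M n₀ v (child τ z false true g)))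
      (M.approx .and (trivApprox M n₀ v (child τ z true true g))
        (trivApprox M n₀ v (child τ z false false g)))
  | some b => M.errSet .and (trivApprox M n₀ v (child τ z true (!b) g))
      (trivApprox M n₀ v (child τ z false b g))

/-- The top error sets are error sets over `𝓜`, hence of probability `≤ d`.
[cite: Pich2024, §3.1, proof of Thm. 2 (p. 9: "by the definition of d")] -/
theorem pr_topErr_le (μ : ProbVector n) {d : ℝ}
    (hd : ∀ (c : Conn) (f₁ f₂ : (Fin n → Bool) → Bool), f₁ ∈ M.carrier → f₂ ∈ M.carrier →
      μ.pr (M.errSet c f₁ f₂) ≤ d) (g : TruthTable n₀) (t : Option Bool) :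
    μ.pr (topErr M v τ z g t) ≤ d := by
  rcases t with _ | b
  · exact hd _ _ _ (M.approx_mem _ _ _ (trivApprox_mem M _ _ _) (trivApprox_mem M _ _ _))
      (M.approx_mem _ _ _ (trivApprox_mem M _ _ _) (trivApprox_mem M _ _ _))
  · exact hd _ _ _ (trivApprox_mem M _ _ _) (trivApprox_mem M _ _ _)

/-- **Claim 3.1 at the top of `D_g`** (which computes `f`: `D_g = (f ⊕ g ⊕ g) = f`): if
`D̄_g(x) ≠ f(x)` then `x` lies in the error set of one of the three top gates, or one of the four
approximators `C̄_{f⊕g}, C̄_{¬g}, C̄_{¬(f⊕g)}, C̄_g` errs at `x`. (`z` is the zero table.)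
[cite: Pich2024, §3.1 Claim 3.1 with proof (p. 10: "the error can occur either in one of the top 3 gates of D_g or in one of the remaining 4 subcircuits")] -/
theorem topApprox_ne (hz : ∀ y, TruthTable.eval n₀ z y = false) (g : TruthTable n₀)
    (x : Fin n → Bool) (hne : topApprox M v τ z g x ≠ TruthTable.eval n₀ τ (x ∘ v)) :
    (∃ t, x ∈ topErr M v τ z g t) ∨
      ∃ ab : Bool × Bool, trivApprox M n₀ v (child τ z ab.1 ab.2 g) x ≠
        TruthTable.eval n₀ (child τ z ab.1 ab.2 g) (x ∘ v) := by
  by_contra hcon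
  push Not at hcon
  obtain ⟨herr, hch⟩ := hcon
  apply hne
  have h0 := herr none
  have h1 := herr (some true)
  have h2 := herr (some false)
  simp only [topErr, mem_errSet_iff, not_not, Conn.apply, Bool.not_true, Bool.not_false]
    at h0 h1 h2
  rw [topApprox, ← h0, ← h2, ← h1, hch (true, false), hch (false, true), hch (true, true),
    hch (false, false)]
  simp only [child, TruthTable.eval_mix, cond_true, cond_false, hz]
  cases TruthTable.eval n₀ τ (x ∘ v) <;> cases TruthTable.eval n₀ g (x ∘ v) <;> rfl

/-- **Lemma 1 at a point `x`**: `Pr_g[D̄_g(x) ≠ f(x)] ≤ Σ_{top types} Pr_g[x ∈ δ] + 4·lvlBound(x)`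
(union bound over the `3 + 12n₀` positions; the four sub-tables are uniformly random).
[cite: Pich2024, §3.1 Lemma 1 with proof (pp. 9–10)] -/
theorem avg_topApprox_ne_le (hz : ∀ y, TruthTable.eval n₀ z y = false) (x : Fin n → Bool) :
    TruthTable.avg n₀ (fun g => ind (topApprox M v τ z g x ≠ TruthTable.eval n₀ τ (x ∘ v))) ≤
      (∑ t : Option Bool, TruthTable.avg n₀ fun g => ind (x ∈ topErr M v τ z g t)) +
        4 * lvlBound M n₀ v x := by
  classical
  have hpt : ∀ g : TruthTable n₀, ind (topApprox M v τ z g x ≠ TruthTable.eval n₀ τ (x ∘ v)) ≤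
      (∑ t : Option Bool, ind (x ∈ topErr M v τ z g t)) +
        ∑ ab : Bool × Bool, ind (trivApprox M n₀ v (child τ z ab.1 ab.2 g) x ≠
          TruthTable.eval n₀ (child τ z ab.1 ab.2 g) (x ∘ v)) := by
    intro g
    refine (ind_imp_le (topApprox_ne M v τ z hz g x)).trans ((ind_or_le _ _).trans ?_)
    gcongr <;> exact ind_exists_le _
  refine (TruthTable.avg_mono hpt).trans ?_
  rw [TruthTable.avg_add, TruthTable.avg_sum, TruthTable.avg_sum]
  refine add_le_add le_rfl ?_
  have hch : ∀ ab : Bool × Bool,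
      TruthTable.avg n₀ (fun g => ind (trivApprox M n₀ v (child τ z ab.1 ab.2 g) x ≠
        TruthTable.eval n₀ (child τ z ab.1 ab.2 g) (x ∘ v))) ≤ lvlBound M n₀ v x := by
    intro ab
    have key := TruthTable.avg_comp_involutive
      (fun h => ind (trivApprox M n₀ v h x ≠ TruthTable.eval n₀ h (x ∘ v)))
      (child_involutive τ z ab.1 ab.2)
    exact key.le.trans (avg_trivApprox_ne_le M n₀ v x)
  calc _ ≤ ∑ _ab : Bool × Bool, lvlBound M n₀ v x := sum_le_sum fun ab _ => hch ab
    _ = 4 * lvlBound M n₀ v x := by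
      simp only [sum_const, card_univ, Fintype.card_prod, Fintype.card_bool, nsmul_eq_mul]
      norm_num

/-- **Lemma 1, averaged over `x ∼ μ`**: `E_g Pr_μ[D̄_g ≠ f] ≤ (3 + 12n₀)·d ≤ 12(n₀+1)·d`.
[cite: Pich2024, §3.1, proof of Thm. 2, "moreover" part (p. 9: Pr[𝐡(𝐱) ≠ f(𝐱)] ≤ 12(n₀+1)Pr[𝐱 ∈ 𝛅] ≤ 12(n₀+1)d)] -/
theorem avg_pr_topApprox_ne_le (hz : ∀ y, TruthTable.eval n₀ z y = false) (μ : ProbVector n)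
    {d : ℝ}
    (hd : ∀ (c : Conn) (f₁ f₂ : (Fin n → Bool) → Bool), f₁ ∈ M.carrier → f₂ ∈ M.carrier →
      μ.pr (M.errSet c f₁ f₂) ≤ d) :
    TruthTable.avg n₀
        (fun g => ∑ x, μ.w x * ind (topApprox M v τ z g x ≠ TruthTable.eval n₀ τ (x ∘ v))) ≤
      12 * (n₀ + 1) * d := by
  rw [← sum_mul_avg]
  have step1 : ∑ x, μ.w x *
        TruthTable.avg n₀ (fun g => ind (topApprox M v τ z g x ≠ TruthTable.eval n₀ τ (x ∘ v))) ≤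
      ∑ x, μ.w x * ((∑ t : Option Bool, TruthTable.avg n₀ fun g => ind (x ∈ topErr M v τ z g t)) +
        4 * lvlBound M n₀ v x) :=
    sum_le_sum fun x _ =>
      mul_le_mul_of_nonneg_left (avg_topApprox_ne_le M v τ z hz x) (μ.nonneg x)
  refine step1.trans ?_
  simp only [mul_add, sum_add_distrib, mul_sum]
  rw [sum_comm]
  have htop : ∀ t : Option Bool,
      ∑ x, μ.w x * TruthTable.avg n₀ (fun g => ind (x ∈ topErr M v τ z g t)) ≤ d := by
    intro t
    rw [sum_mul_avg]
    refine TruthTable.avg_le_of_le fun g => ?_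
    rw [← pr_eq_sum_ind μ]
    exact pr_topErr_le M v τ z μ hd g t
  have h3 : ∑ t : Option Bool,
      ∑ x, μ.w x * TruthTable.avg n₀ (fun g => ind (x ∈ topErr M v τ z g t)) ≤ 3 * d := by
    calc _ ≤ ∑ _t : Option Bool, d := sum_le_sum fun t _ => htop t
      _ = 3 * d := by
        simp only [sum_const, card_univ, Fintype.card_option, Fintype.card_bool, nsmul_eq_mul]
        norm_num
  have hl : ∑ x, μ.w x * (4 * lvlBound M n₀ v x) ≤ 4 * (3 * n₀ * d) := by
    simp only [mul_left_comm _ (4 : ℝ), ← mul_sum]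
    exact mul_le_mul_of_nonneg_left (sum_mul_lvlBound_le M μ hd n₀ v) (by norm_num)
  have hd0 : 0 ≤ d :=
    le_trans (μ.pr_nonneg _) (hd .or _ _ (M.const_mem false) (M.const_mem false))
  nlinarith

end Top

end ApproximationMethod

/-! ### The discharge -/

open ApproximationMethod in

/-- **The limit of the probabilistic approximation method (Razborov 1989; Pich 2024, Thm. 2,
"moreover" part), proved: `ρ(f, 𝓜, x) ≤ 12(n₀+1)`.** For every legitimate model `𝓜` of order `n`
over `{¬, ∨₂, ∧₂}` with `¬̄ = ¬`, every `f` with `n₀` essential inputs, every probability vector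
`μ` and every `d > 0` bounding the probabilities of all error sets over `𝓜`, some `g ∈ 𝓜` — namely
a good instance `D̄_g` of the random approximator of Lemma 1, built over the essential inputs —
has `Pr_μ[f ≠ g] ≤ 12(n₀+1)·d`. [cite: Pich2024, §3.1 Thm. 2 and Lemma 1 with proofs (pp. 9–10)] -/
theorem ApproximationMethodLimitProb_holds : ApproximationMethodLimitProb := by
  intro n M f μ d _hdpos hd
  classical
  -- the essential inputs, enumerated by `v`
  set E := essentialInputs f
  set n₀ := E.card
  let e : {i // i ∈ E} ≃ Fin n₀ := E.equivFin
  let v : Fin n₀ → Fin n := fun j => (e.symm j).1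
  let ext : (Fin n₀ → Bool) → Fin n → Bool := fun y i => if hi : i ∈ E then y (e ⟨i, hi⟩) else false
  let f' : (Fin n₀ → Bool) → Bool := fun y => f (ext y)
  have hf : ∀ x, f x = f' (x ∘ v) := by
    intro x
    refine (apply_eq_of_agree_essential f x (ext (x ∘ v)) fun i hi => ?_).symm
    have hiE : i ∈ E := (mem_essentialInputs f i).2 hi
    simp [ext, v, hiE]
  -- the tables of `f` (as a function of its essential inputs) and of `0`
  let τ : TruthTable n₀ := TruthTable.ofFun n₀ f'
  let z : TruthTable n₀ := TruthTable.ofFun n₀ fun _ => false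
  have hz : ∀ y, TruthTable.eval n₀ z y = false := fun y => TruthTable.eval_ofFun n₀ _ y
  have hτ : ∀ x, TruthTable.eval n₀ τ (x ∘ v) = f x := fun x => by rw [TruthTable.eval_ofFun, hf]
  -- Lemma 1 averaged over `μ`, and a `g` at least as good as the average
  have havg := avg_pr_topApprox_ne_le M v τ z hz μ hd
  obtain ⟨g, hg⟩ := TruthTable.exists_le_of_avg_le havg
  refine ⟨topApprox M v τ z g, topApprox_mem M v τ z g, le_trans (le_of_eq ?_) hg⟩
  rw [pr_eq_sum_ind μ]
  refine sum_congr rfl fun x _ => ?_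
  unfold ind
  rw [hτ x]
  simp only [mem_filter, mem_univ, true_and]
  exact congrArg _ (if_congr ne_comm rfl rfl)

/-- The quotient form, as printed: with `d` the maximum error-set probability (attained, `d ≠ 0`),
`ρ(f, 𝓜, x) = min_{g ∈ 𝓜} Pr[f(x) ≠ g(x)] / d ≤ 12(n₀+1)`.
[cite: Pich2024, §2.1 (p. 8: probabilistic approach) and §3.1 Thm. 2 (p. 9)] -/
theorem exists_mem_pr_ne_div_le (M : LegitimateModel n) (f : (Fin n → Bool) → Bool)
    (μ : ProbVector n) {d : ℝ} (hdpos : 0 < d)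
    (hd : ∀ (c : Conn) (f₁ f₂ : (Fin n → Bool) → Bool), f₁ ∈ M.carrier → f₂ ∈ M.carrier →
      μ.pr (M.errSet c f₁ f₂) ≤ d) :
    ∃ g ∈ M.carrier,
      μ.pr (univ.filter fun x => f x ≠ g x) / d ≤ 12 * ((essentialInputs f).card + 1) := by
  obtain ⟨g, hg, hle⟩ := ApproximationMethodLimitProb_holds n M f μ d hdpos hd
  exact ⟨g, hg, (div_le_iff₀ hdpos).2 hle⟩

end Literature.Barriers.PneNP

end
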